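import Literature.NumberTheory.Automorphic.HilbertRepSpectrumProofs
import HarnessLib

/-!
# Multiplicity one of an irreducible from the projection ("realisation") criterion

Topic `NumberTheory/Automorphic`; sibling of `HilbertRepSpectrum` ∕ `HilbertRepSpectrumProofs`
(unitary representations on Hilbert spaces: closed subrepresentations, topological
irreducibility, unitary equivalence, multiplicity one).

Let `π` be a unitary representation of a group `G` on a complex Hilbert space `H` and `Q` a
topologically irreducible closed invariant subspace, the closed span of a set of vectors `S`.
Consider the two properties

* (R) *realisation*: every topologically irreducible closed invariant `W` whose orthogonal
  projection `pr_W` does not kill every `s ∈ S` is contained in `Q`;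
* (M1) *multiplicity one of the class of `Q`*: every topologically irreducible closed invariant
  `W` unitarily equivalent to `Q` **is** `Q`.

(M1) ⟹ (R) is the unitary Schur dichotomy (Deitmar–Echterhoff (2014), Cor. 6.1.9: an irreducible
`W` not orthogonal to the irreducible `Q` is unitarily equivalent to a closed invariant subspace
of `Q`, i.e. to `Q`); it is derived here (§4) from the tree's
`ClosedSubrep.exists_le_orthogonal_areUnitarilyEquivalent`. The point of this file is the
converse (R) ⟹ (M1)
(`ContRepresentation.ClosedSubrep.eq_of_areUnitarilyEquivalent_of_forall_le_of_starProjection_ne_zero`,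
§3), by von Neumann's *isoclinic copy*: if `W ≃ Q` is an irreducible NOT contained in `Q`, then
`pr_W` kills `S`, so `W ⊥ Q`; with `u : Q → W` an isometric intertwiner, the "diagonal"
`P = {(q + u q)/√2 : q ∈ Q}` is a closed invariant subspace unitarily equivalent to `Q` (hence
irreducible), and `pr_P s ≠ 0` for any non-zero `s ∈ S` (`⟪(s + u s)/√2, s⟫ = ‖s‖²/√2`); so (R)
gives `P ≤ Q`, whence `u s ∈ Q ∩ W = 0` and `s = 0` — a contradiction. Hence every irreducible
`W ≃ Q` lies in `Q` and equals it (`ClosedSubrep.eq_of_le_of_isTopIrreducible`). So, for an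
irreducible closed span `Q`, (R) and (M1) are EQUIVALENT (§4,
`forall_le_of_starProjection_ne_zero_iff_forall_eq_of_areUnitarilyEquivalent`).

Everything is proved; no definitions, no named facts. Consumers: the realisation letter of a
theta correspondence («a discrete `P` with `pr_P θ ≠ 0` for some theta class `θ` lies in the
closed theta span») is thereby EQUIVALENT to multiplicity one of the theta representation as
soon as the theta span is irreducible (Dixmier (1977), §5.4; Deitmar–Echterhoff (2014), §6.1).

## References

* A. Deitmar, S. Echterhoff, *Principles of Harmonic Analysis*, 2nd ed., Springer (2014),
  Lemma 6.1.7, Cor. 6.1.9 [DeitmarEchterhoff2014].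
* J. Dixmier, *C\*-algebras*, North-Holland (1977), §5.4 (quasi-equivalence, isotypic
  components, disjointness) [Dixmier1977].
-/

noncomputable section

open scoped InnerProductSpace
open Topology

namespace ContRepresentation

namespace ClosedSubrep

variable {G H : Type*} [Group G] [NormedAddCommGroup H] [InnerProductSpace ℂ H] [CompleteSpace H]
  {π : ContRepresentation ℂ G H}

/-! ### §1 Orthogonality from the vanishing of projections on a generating set -/

omit [CompleteSpace H] in
/-- If the orthogonal projection onto a complete subspace `K` kills every vector of `S`, then the
closed span of `S` is orthogonal to `K` (Mathlib `Submodule.starProjection_apply_eq_zero_iff`,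
`Submodule.topologicalClosure_minimal`). [folklore] -/
private theorem topologicalClosure_span_le_orthogonal_of_forall_starProjection_eq_zero
    (K : Submodule ℂ H) [K.HasOrthogonalProjection] {S : Set H}
    (hS : ∀ s ∈ S, K.starProjection s = 0) :
    (Submodule.span ℂ S).topologicalClosure ≤ Kᗮ := by
  refine Submodule.topologicalClosure_minimal _ ?_ (Submodule.isClosed_orthogonal K)
  rw [Submodule.span_le]
  intro s hs
  exact (Submodule.starProjection_apply_eq_zero_iff K).1 (hS s hs)

/-! ### §2 The isoclinic copy of an orthogonal equivalent pair -/

omit [CompleteSpace H] in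
/-- **The isoclinic copy.** Let `Q`, `W` be closed invariant subspaces with `Q ⊥ W` (`Q ≤ Wᗮ`)
and `u : Q ≃ W` an isometric intertwiner. Then `U q = (√2)⁻¹ • (q + u q)` is an ISOMETRIC
intertwiner `Q → H` (von Neumann; Dixmier (1977), §5.4; Deitmar–Echterhoff (2014), proof of
Cor. 6.1.9): `‖q + u q‖² = ‖q‖² + ‖u q‖² = 2 ‖q‖²` by orthogonality, and
`π g (q + u q) = π g q + u (π g q)`. Recorded as the existence of a linear isometry with the two
properties its consumers use. [cite: Dixmier1977, §5.4] -/
theorem exists_isoclinic_linearIsometry {Q W : ClosedSubrep π}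
    (hQW : Q.toSubmodule ≤ W.toSubmoduleᗮ) (u : Q.toContRep.Equiv W.toContRep) (hu : Isometry u) :
    ∃ U : Q.toSubmodule →ₗᵢ[ℂ] H,
      (∀ (g : G) (q : Q.toSubmodule), U (Q.toContRep g q) = π g (U q)) ∧
      ∀ q : Q.toSubmodule, U q = ((Real.sqrt 2 : ℂ)⁻¹) • ((q : H) + (u q : H)) := by
  have hnorm : ∀ q : Q.toSubmodule, ‖u q‖ = ‖q‖ := (AddMonoidHomClass.isometry_iff_norm u).1 hu
  -- the underlying linear map `q ↦ (√2)⁻¹ • (q + u q)`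
  let L : Q.toSubmodule →ₗ[ℂ] H :=
    ((Real.sqrt 2 : ℂ)⁻¹) •
      (Q.toSubmodule.subtype + W.toSubmodule.subtype ∘ₗ (u : Q.toSubmodule →ₗ[ℂ] W.toSubmodule))
  have hL : ∀ q : Q.toSubmodule, L q = ((Real.sqrt 2 : ℂ)⁻¹) • ((q : H) + (u q : H)) :=
    fun q => rfl
  -- `‖q + u q‖ ^ 2 = 2 * ‖q‖ ^ 2` by orthogonality of `q ∈ Q` and `u q ∈ W`
  have hsq : ∀ q : Q.toSubmodule, ‖(q : H) + (u q : H)‖ ^ 2 = 2 * ‖(q : H)‖ ^ 2 := by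
    intro q
    have h0 : ⟪(q : H), (u q : H)⟫_ℂ = 0 :=
      Submodule.inner_left_of_mem_orthogonal (K := W.toSubmodule) (u q).2 (hQW q.2)
    rw [@norm_add_sq ℂ, h0, map_zero, mul_zero, add_zero]
    have : ‖(u q : H)‖ = ‖(q : H)‖ := hnorm q
    rw [this]
    ring
  have hs : (0 : ℝ) < Real.sqrt 2 := Real.sqrt_pos.2 (by norm_num)
  have hsqrt : (Real.sqrt 2 : ℂ) ≠ 0 := by exact_mod_cast hs.ne'
  have hnormL : ∀ q : Q.toSubmodule, ‖L q‖ = ‖q‖ := by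
    intro q
    rw [hL q, norm_smul]
    have h2 : ‖(q : H) + (u q : H)‖ = Real.sqrt 2 * ‖(q : H)‖ := by
      rw [← Real.sqrt_sq (norm_nonneg ((q : H) + (u q : H))), hsq q,
        Real.sqrt_mul' _ (sq_nonneg _), Real.sqrt_sq (norm_nonneg _)]
    rw [h2, Submodule.coe_norm,
      show ‖((Real.sqrt 2 : ℂ)⁻¹)‖ = (Real.sqrt 2)⁻¹ by
        rw [norm_inv, Complex.norm_real, Real.norm_eq_abs, abs_of_pos hs]]
    field_simp
  refine ⟨⟨L, hnormL⟩, fun g q => ?_, fun q => hL q⟩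
  -- intertwining
  change L (Q.toContRep g q) = π g (L q)
  have hint : (u (Q.toContRep g q) : H) = π g (u q : H) := by
    have h := u.toContIntertwiningMap.isIntertwining g q
    rw [Equiv.coe_toContIntertwiningMap] at h
    rw [h]
    rfl
  rw [hL, hL, hint, coe_toContRep_apply, map_smul, map_add]

/-! ### §3 (R) ⟹ (M1): multiplicity one from the projection criterion -/

/-- **Multiplicity one of an irreducible closed span from the realisation (projection)
criterion.** Let `π` be unitary, `Q` a topologically irreducible closed invariant subspace and
`S ⊆ Q` a set of vectors whose closed span contains `Q` (so `Q` is the closed span of `S`).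
Suppose (R): every topologically irreducible closed invariant `W` with `pr_W s ≠ 0` for some
`s ∈ S` satisfies `W ≤ Q`. Then every topologically irreducible closed invariant `W` unitarily
equivalent to `Q` EQUALS `Q`. Proof: if `pr_W s ≠ 0` for some `s ∈ S`, (R) and
`eq_of_le_of_isTopIrreducible`; otherwise `Q ⊥ W`, and the isoclinic copy
`P = {(q + u q)/√2}` (`exists_isoclinic_linearIsometry`, `ofLinearIsometry`) is an irreducible
closed invariant subspace with `pr_P s ≠ 0` for a non-zero `s ∈ S` (`⟪(s + u s)/√2, s⟫ = ‖s‖²/√2`),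
so `P ≤ Q` by (R), forcing `u s ∈ Q ∩ W = 0`, `s = 0`: contradiction.
[cite: DeitmarEchterhoff2014, Cor. 6.1.9] [cite: Dixmier1977, §5.4] -/
theorem eq_of_areUnitarilyEquivalent_of_forall_le_of_starProjection_ne_zero (hπ : π.IsUnitary)
    {Q : ClosedSubrep π} (hQ : Q.toContRep.IsTopIrreducible) {S : Set H} (hSQ : S ⊆ Q)
    (hQS : Q.toSubmodule ≤ (Submodule.span ℂ S).topologicalClosure)
    (hR : ∀ W : ClosedSubrep π, W.toContRep.IsTopIrreducible →
      (∃ s ∈ S, W.toSubmodule.starProjection s ≠ 0) → W ≤ Q)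
    {W : ClosedSubrep π} (hW : W.toContRep.IsTopIrreducible)
    (he : AreUnitarilyEquivalent W.toContRep Q.toContRep) : W = Q := by
  have _ := hπ
  have hWnt : Nontrivial W.toSubmodule := ((isTopIrreducible_iff _).1 hW).1
  by_cases hcase : ∃ s ∈ S, W.toSubmodule.starProjection s ≠ 0
  · exact eq_of_le_of_isTopIrreducible hQ hWnt (hR W hW hcase)
  -- otherwise `pr_W` kills `S`, hence its closed span, hence `Q`: `Q ⊥ W`
  exfalso
  push Not at hcase
  have hQW : Q.toSubmodule ≤ W.toSubmoduleᗮ :=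
    hQS.trans (topologicalClosure_span_le_orthogonal_of_forall_starProjection_eq_zero _ hcase)
  -- an isometric intertwiner `u : Q → W`
  obtain ⟨u, hu⟩ := he.symm
  have hnorm : ∀ q : Q.toSubmodule, ‖u q‖ = ‖q‖ := (AddMonoidHomClass.isometry_iff_norm u).1 hu
  -- the isoclinic copy `P`, irreducible as it is equivalent to `Q`
  obtain ⟨U, hUint, hUapply⟩ := exists_isoclinic_linearIsometry hQW u hu
  let P : ClosedSubrep π := ofLinearIsometry U hUint
  have hPirr : P.toContRep.IsTopIrreducible :=
    (isTopIrreducible_congr (equivOfLinearIsometry U hUint)).1 hQ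
  -- a non-zero generator `s ∈ S` (`Q ≠ 0` lies in the closed span of `S`)
  obtain ⟨s, hsS, hs0⟩ : ∃ s ∈ S, s ≠ 0 := by
    by_contra hnone
    push Not at hnone
    have hspan : Submodule.span ℂ S ≤ ⊥ := by
      rw [Submodule.span_le]
      intro s hs
      simp [hnone s hs]
    have hcl : (Submodule.span ℂ S).topologicalClosure ≤ ⊥ :=
      Submodule.topologicalClosure_minimal _ hspan
        (by rw [Submodule.bot_coe]; exact isClosed_singleton)
    have hQnt : Nontrivial Q.toSubmodule := ((isTopIrreducible_iff _).1 hQ).1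
    obtain ⟨⟨q, hq⟩, hqne⟩ := exists_ne (0 : Q.toSubmodule)
    exact hqne (Subtype.ext ((Submodule.mem_bot ℂ).1 (hcl (hQS hq))))
  have hsQ : s ∈ Q.toSubmodule := hSQ hsS
  have hsqrt : (Real.sqrt 2 : ℂ) ≠ 0 := by
    exact_mod_cast (Real.sqrt_pos.2 (by norm_num : (0 : ℝ) < 2)).ne'
  have hs2 : ((Real.sqrt 2 : ℂ)⁻¹) ≠ 0 := inv_ne_zero hsqrt
  -- `u s ⊥ s`
  have hus : ⟪(u ⟨s, hsQ⟩ : H), s⟫_ℂ = 0 :=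
    Submodule.inner_right_of_mem_orthogonal (K := W.toSubmodule) (u ⟨s, hsQ⟩).2 (hQW hsQ)
  -- `pr_P s ≠ 0`: `U s ∈ P` has `⟪U s, s⟫ = ‖s‖² / √2 ≠ 0`, so `s ∉ Pᗮ`
  have hPs : P.toSubmodule.starProjection s ≠ 0 := by
    intro h0
    have hsP : s ∈ P.toSubmoduleᗮ := (Submodule.starProjection_apply_eq_zero_iff _).1 h0
    have hUs : (U ⟨s, hsQ⟩ : H) ∈ P.toSubmodule := ⟨⟨s, hsQ⟩, rfl⟩
    have hinner : ⟪U ⟨s, hsQ⟩, s⟫_ℂ = 0 := Submodule.inner_right_of_mem_orthogonal hUs hsP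
    rw [hUapply, inner_smul_left, inner_add_left, hus, add_zero] at hinner
    rcases mul_eq_zero.1 hinner with h | h
    · exact (map_ne_zero (starRingEnd ℂ)).2 hs2 h
    · exact hs0 (inner_self_eq_zero.1 h)
  -- so (R) gives `P ≤ Q`, and then `u s ∈ Q ∩ W = 0`
  have hPQ : P ≤ Q := hR P hPirr ⟨s, hsS, hPs⟩
  have hUsQ : (U ⟨s, hsQ⟩ : H) ∈ Q.toSubmodule :=
    hPQ (show U ⟨s, hsQ⟩ ∈ P from ⟨⟨s, hsQ⟩, rfl⟩)
  have husQ : (u ⟨s, hsQ⟩ : H) ∈ Q.toSubmodule := by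
    rw [hUapply] at hUsQ
    have h1 : (s : H) + (u ⟨s, hsQ⟩ : H) ∈ Q.toSubmodule := by
      have := Q.toSubmodule.smul_mem (Real.sqrt 2 : ℂ) hUsQ
      rwa [smul_smul, mul_inv_cancel₀ hsqrt, one_smul] at this
    simpa using Q.toSubmodule.sub_mem h1 hsQ
  have hus0 : (u ⟨s, hsQ⟩ : H) = 0 := by
    have hW' : (u ⟨s, hsQ⟩ : H) ∈ W.toSubmoduleᗮ := hQW husQ
    exact inner_self_eq_zero.1 (Submodule.inner_right_of_mem_orthogonal (u ⟨s, hsQ⟩).2 hW')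
  have hn : ‖(⟨s, hsQ⟩ : Q.toSubmodule)‖ = 0 := by
    rw [← hnorm, Submodule.coe_norm, hus0, norm_zero]
  exact hs0 (norm_eq_zero.1 hn)

/-- The same with `S = Q` (no generating set singled out): if every irreducible `W` seeing some
vector of the irreducible `Q` through `pr_W` lies in `Q`, then every irreducible `W ≃ Q` is `Q`.
[cite: DeitmarEchterhoff2014, Cor. 6.1.9] -/
theorem eq_of_areUnitarilyEquivalent_of_forall_le_of_starProjection_ne_zero' (hπ : π.IsUnitary)
    {Q : ClosedSubrep π} (hQ : Q.toContRep.IsTopIrreducible)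
    (hR : ∀ W : ClosedSubrep π, W.toContRep.IsTopIrreducible →
      (∃ v ∈ (Q : Set H), W.toSubmodule.starProjection v ≠ 0) → W ≤ Q)
    {W : ClosedSubrep π} (hW : W.toContRep.IsTopIrreducible)
    (he : AreUnitarilyEquivalent W.toContRep Q.toContRep) : W = Q :=
  eq_of_areUnitarilyEquivalent_of_forall_le_of_starProjection_ne_zero hπ hQ (S := (Q : Set H))
    subset_rfl (fun _ hq => Submodule.le_topologicalClosure _ (Submodule.subset_span hq)) hR hW he

/-! ### §4 (M1) ⟹ (R) and the equivalence -/

/-- **(M1) ⟹ (R)** (the unitary Schur dichotomy, Deitmar–Echterhoff (2014), Cor. 6.1.9). If the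
irreducible `Q` has multiplicity one in the sense «every irreducible `W ≃ Q` is `Q`», then an
irreducible `W` with `pr_W v ≠ 0` for some `v ∈ Q` contains `Q`, hence equals it: `Q ≰ Wᗮ`, so
the isometric part of the compressed projection `P_{Wᗮᗮ}|_Q`
(`exists_le_orthogonal_areUnitarilyEquivalent`) exhibits an irreducible `Q'' ≤ Wᗮᗮ = W`
equivalent to `Q`, `Q'' = Q` by (M1), and `Q = W` by irreducibility of `W`.
[cite: DeitmarEchterhoff2014, Cor. 6.1.9] -/
theorem le_of_starProjection_ne_zero_of_forall_eq_of_areUnitarilyEquivalent (hπ : π.IsUnitary)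
    {Q : ClosedSubrep π} (hQ : Q.toContRep.IsTopIrreducible)
    (hM1 : ∀ W : ClosedSubrep π, W.toContRep.IsTopIrreducible →
      AreUnitarilyEquivalent W.toContRep Q.toContRep → W = Q)
    {W : ClosedSubrep π} (hW : W.toContRep.IsTopIrreducible)
    {v : H} (hv : v ∈ Q) (hne : W.toSubmodule.starProjection v ≠ 0) : W ≤ Q := by
  have hQW : ¬ Q ≤ W.orthogonal hπ := fun hle =>
    hne ((Submodule.starProjection_apply_eq_zero_iff _).2 (hle hv))
  obtain ⟨Q'', hQ''le, hQQ''⟩ :=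
    exists_le_orthogonal_areUnitarilyEquivalent hπ (W.orthogonal hπ) Q hQ hQW
  rw [orthogonal_orthogonal] at hQ''le
  -- `Q''` is irreducible and equivalent to `Q`, hence `= Q` by (M1); so `Q ≤ W`, and `Q = W`
  obtain ⟨e, he⟩ := hQQ''
  have hQ''irr : Q''.toContRep.IsTopIrreducible := (isTopIrreducible_congr e).1 hQ
  have hQ''Q : Q'' = Q := hM1 Q'' hQ''irr ⟨e.symm, he.right_inv e.right_inv⟩
  rw [hQ''Q] at hQ''le
  have hQnt : Nontrivial Q.toSubmodule := ((isTopIrreducible_iff _).1 hQ).1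
  exact le_of_eq (eq_of_le_of_isTopIrreducible hW hQnt hQ''le).symm

/-- **(R) ⟺ (M1) for an irreducible closed span.** For unitary `π`, a topologically irreducible
closed invariant `Q` and `S ⊆ Q` with `Q` inside the closed span of `S`: «every irreducible `W`
with `pr_W s ≠ 0` for some `s ∈ S` lies in `Q`» iff «every irreducible `W` unitarily equivalent
to `Q` is `Q`». [cite: DeitmarEchterhoff2014, Cor. 6.1.9] [cite: Dixmier1977, §5.4] -/
theorem forall_le_of_starProjection_ne_zero_iff_forall_eq_of_areUnitarilyEquivalent
    (hπ : π.IsUnitary) {Q : ClosedSubrep π} (hQ : Q.toContRep.IsTopIrreducible) {S : Set H}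
    (hSQ : S ⊆ Q) (hQS : Q.toSubmodule ≤ (Submodule.span ℂ S).topologicalClosure) :
    (∀ W : ClosedSubrep π, W.toContRep.IsTopIrreducible →
        (∃ s ∈ S, W.toSubmodule.starProjection s ≠ 0) → W ≤ Q) ↔
      ∀ W : ClosedSubrep π, W.toContRep.IsTopIrreducible →
        AreUnitarilyEquivalent W.toContRep Q.toContRep → W = Q := by
  constructor
  · intro hR W hW he
    exact eq_of_areUnitarilyEquivalent_of_forall_le_of_starProjection_ne_zero hπ hQ hSQ hQS hR hW he
  · rintro hM1 W hW ⟨s, hs, hne⟩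
    exact le_of_starProjection_ne_zero_of_forall_eq_of_areUnitarilyEquivalent hπ hQ hM1 hW
      (hSQ hs) hne

end ClosedSubrep

end ContRepresentation

end
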